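/-
Copyright: rh-split cell, seat prover-l1-w2 (L1 «DUST WALL», width seat 2), 2026-08-27.  ζ-free analysis.
Nothing here bears on the truth of RH.
-/
import Summits.RiemannHypothesis.RiemannHypothesis.Theorems.Splittings.ScrewDustCellFlux
import Summits.RiemannHypothesis.RiemannHypothesis.Theorems.Splittings.ScrewBorelGaussB
import HarnessLib

/-!
# Gauss's law for GRID CYCLES — part A: one slope term on a rectangle, termwise integration,
the identity `dslope F 0 = slope series` on a linked region

ζ-free kernel pieces for the line X-11 «DUST WALL» (route `ScrewDustWall`, crux
`PointComponentInvisible`, stmt-RiemannHypothesis-21690) and for the cycle row `CycleEncirclable`.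
Data as in `ScrewBorelContinuation`: `c : ι → ℂ` absolutely summable (`Re (c i) < 0` where signs
matter), `u i ≠ 0`, the Borel series `B = ∑' i, term (c i) (u i)`, its inside pole set `poleSet u ⊆ 𝔻`,
and `F` holomorphic on `𝔻` equal to `B` on a pole-free disc `ball 0 r₀`.

`ScrewDustCellFlux.cellComplex_charge_eq_zero` (prover-l1) computes the flux of `B dz` through the
boundary cycle of a finite cell complex: the enclosed charge `∑ (c/2)·q` carries the positional factor
`q`, so a contradiction needs shrinking cycles (Tannery).  This part and part B
(`ScrewDustCycleGauss`) run the same bookkeeping for the SLOPE SERIES `∑' slopeTerm (c i) (u i) = B(z)/z`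
of `ScrewBorelGauss` (residue `-c/2` at each pole, NO positional factor) against `dslope F 0`:

* `rectBoundaryIntegral_slopeTerm` (§1): `∮_{∂K} slopeTerm c u = -2πi·(c/2)·#{poles of the term in
  K°}` for a closed rectangle `K ⊆ 𝔻` with admissible poles; the pure charge has norm `≤ ‖c‖` and
  real part `≤ 0`, `< 0` at an enclosed pole (`norm_cellCharge_le`, `re_cellCharge_nonpos/neg`);
* `hasSum_intervalIntegral_slope`, `eqOn_dslope_of_preconnected`, `hasSum_integral_path_slope` (§2):
  termwise integration on separated segments and the identity `dslope F 0 = slope series` on any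
  preconnected `V ∋ 0` inside `𝔻 ∖ closure (poleSet u)`.

No `sorry`, no new axioms, no definitions, no instances, no notation.
-/

set_option linter.dupNamespace false

namespace Summit.RiemannHypothesis.RiemannHypothesis.Theorems.Splittings.ScrewDust

open Complex Filter Topology Set Metric MeasureTheory
open scoped Real Interval Classical
open Summit.RiemannHypothesis.RiemannHypothesis.Theorems.Splittings.ScrewBorel
open Summit.RiemannHypothesis.RiemannHypothesis.Theorems.Splittings.ScrewBorelFlux
open Summit.RiemannHypothesis.RiemannHypothesis.Theorems.Splittings.ScrewBorelGauss
open Literature.Analysis.Complex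

/-! ## 1. The residue of one slope term on a rectangle -/

/-- Partial fractions for the slope term (an identity of junk-valued functions, no hypothesis):
`slopeTerm c u z = -(c/2)·(z - u⁻¹)⁻¹ - (c/2)·(z - u)⁻¹ + c·(z - 1)⁻¹`. -/
theorem slopeTerm_eq_pieces (c u z : ℂ) :
    slopeTerm c u z = (-(c / 2)) * (z - u⁻¹)⁻¹ + (-(c / 2)) * (z - u)⁻¹ + c * (z - 1)⁻¹ := by
  have h1 : (u⁻¹ - z)⁻¹ = -(z - u⁻¹)⁻¹ := by rw [← neg_sub z u⁻¹, inv_neg]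
  have h2 : (u - z)⁻¹ = -(z - u)⁻¹ := by rw [← neg_sub z u, inv_neg]
  have h3 : (1 - z)⁻¹ = -(z - 1)⁻¹ := by rw [← neg_sub z 1, inv_neg]
  unfold slopeTerm
  rw [h1, h2, h3]
  ring

/-- The PURE CHARGE the term `(c, u)` puts on a set `U` — `c/2` for each of its poles `q ∈ {u⁻¹, u}`
lying in `U`, written out as `(if u⁻¹ ∈ U then c/2 else 0) + (if u ∈ U then c/2 else 0)` throughout
(cf. `ScrewBorelGauss.chargeWeight` for discs) — has norm `≤ ‖c‖`. -/
theorem norm_cellCharge_le (c u : ℂ) (U : Set ℂ) :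
    ‖(if u⁻¹ ∈ U then c / 2 else 0) + (if u ∈ U then c / 2 else 0)‖ ≤ ‖c‖ := by
  have h2 : ‖c / 2‖ = ‖c‖ / 2 := by rw [norm_div]; simp
  have h0 := norm_nonneg c
  refine (norm_add_le _ _).trans ?_
  split_ifs <;> simp only [h2, norm_zero] <;> linarith

/-- The real part of the pure charge is `≤ 0` when `Re c < 0`. -/
theorem re_cellCharge_nonpos {c : ℂ} (hc : c.re < 0) (u : ℂ) (U : Set ℂ) :
    ((if u⁻¹ ∈ U then c / 2 else 0) + (if u ∈ U then c / 2 else 0)).re ≤ 0 := by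
  have h2 : (c / 2).re = c.re / 2 := by simp
  rw [Complex.add_re]
  split_ifs <;> simp only [h2, Complex.zero_re] <;> linarith

/-- The real part of the pure charge is `< 0` when `Re c < 0` and a pole of the term lies in `U`. -/
theorem re_cellCharge_neg {c : ℂ} (hc : c.re < 0) {u p : ℂ} {U : Set ℂ} (hp : p = u ∨ p = u⁻¹)
    (hpU : p ∈ U) :
    ((if u⁻¹ ∈ U then c / 2 else 0) + (if u ∈ U then c / 2 else 0)).re < 0 := by
  have h2 : (c / 2).re = c.re / 2 := by simp
  rw [Complex.add_re]
  rcases hp with rfl | rfl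
  · rw [if_pos hpU]
    split_ifs <;> simp only [h2, Complex.zero_re] <;> linarith
  · rw [if_pos hpU]
    split_ifs <;> simp only [h2, Complex.zero_re] <;> linarith

/-- **Flux of one slope term through a rectangle.**  If the closed rectangle `K = [x₁,x₂] × [y₁,y₂]`
lies in the unit disc and the poles `u`, `u⁻¹` are admissible (in `K°` or off `K`), then
`∮_{∂K} slopeTerm c u = -2πi ·` (pure charge of the term in `K°`). -/
theorem rectBoundaryIntegral_slopeTerm {c u : ℂ} {x₁ x₂ y₁ y₂ : ℝ} (hx : x₁ ≤ x₂)
    (hy : y₁ ≤ y₂) (hsub : Icc x₁ x₂ ×ℂ Icc y₁ y₂ ⊆ ball (0 : ℂ) 1)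
    (hu₁ : u ∈ Ioo x₁ x₂ ×ℂ Ioo y₁ y₂ ∨ u ∉ Icc x₁ x₂ ×ℂ Icc y₁ y₂)
    (hu₂ : u⁻¹ ∈ Ioo x₁ x₂ ×ℂ Ioo y₁ y₂ ∨ u⁻¹ ∉ Icc x₁ x₂ ×ℂ Icc y₁ y₂) :
    rectBoundaryIntegral (slopeTerm c u) x₁ x₂ y₁ y₂ =
      -(2 * π * I) * ((if u⁻¹ ∈ Ioo x₁ x₂ ×ℂ Ioo y₁ y₂ then c / 2 else 0) +
        (if u ∈ Ioo x₁ x₂ ×ℂ Ioo y₁ y₂ then c / 2 else 0)) := by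
  have h1out : (1 : ℂ) ∉ Icc x₁ x₂ ×ℂ Icc y₁ y₂ := fun h ↦ by
    have := hsub h
    rw [mem_ball_zero_iff, norm_one] at this
    exact lt_irrefl _ this
  have h1in : (1 : ℂ) ∉ Ioo x₁ x₂ ×ℂ Ioo y₁ y₂ := fun h ↦
    h1out ⟨Ioo_subset_Icc_self h.1, Ioo_subset_Icc_self h.2⟩
  have h1 : (1 : ℂ) ∈ Ioo x₁ x₂ ×ℂ Ioo y₁ y₂ ∨ (1 : ℂ) ∉ Icc x₁ x₂ ×ℂ Icc y₁ y₂ := Or.inr h1out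
  have e : slopeTerm c u = fun z ↦ ((-(c / 2)) * (z - u⁻¹)⁻¹ + (-(c / 2)) * (z - u)⁻¹) +
      c * (z - 1)⁻¹ := funext fun z ↦ slopeTerm_eq_pieces c u z
  have hA := continuousAt_mul_inv_sub_of_offRect (-(c / 2)) hu₂
  have hB := continuousAt_mul_inv_sub_of_offRect (-(c / 2)) hu₁
  have hC := continuousAt_mul_inv_sub_of_offRect c h1
  have s1 : rectBoundaryIntegral (fun z ↦ ((-(c / 2)) * (z - u⁻¹)⁻¹ +
        (-(c / 2)) * (z - u)⁻¹) + c * (z - 1)⁻¹) x₁ x₂ y₁ y₂ =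
      rectBoundaryIntegral (fun z ↦ (-(c / 2)) * (z - u⁻¹)⁻¹ + (-(c / 2)) * (z - u)⁻¹)
        x₁ x₂ y₁ y₂ + rectBoundaryIntegral (fun z ↦ c * (z - 1)⁻¹) x₁ x₂ y₁ y₂ := by
    exact rectBoundaryIntegral_add' hx hy (fun z hz hbd ↦ (hA z hz hbd).add (hB z hz hbd)) hC
  have s2 : rectBoundaryIntegral (fun z ↦ (-(c / 2)) * (z - u⁻¹)⁻¹ +
        (-(c / 2)) * (z - u)⁻¹) x₁ x₂ y₁ y₂ =
      rectBoundaryIntegral (fun z ↦ (-(c / 2)) * (z - u⁻¹)⁻¹) x₁ x₂ y₁ y₂ +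
        rectBoundaryIntegral (fun z ↦ (-(c / 2)) * (z - u)⁻¹) x₁ x₂ y₁ y₂ := by
    exact rectBoundaryIntegral_add' hx hy hA hB
  rw [e, s1, s2, rectBoundaryIntegral_mul_inv_sub _ hx hy hu₂,
    rectBoundaryIntegral_mul_inv_sub _ hx hy hu₁, rectBoundaryIntegral_mul_inv_sub _ hx hy h1,
    if_neg h1in]
  split_ifs <;> ring

/-! ## 2. Termwise integration of the slope series; the identity `dslope F 0 = slope series` on `V` -/

/-- **`∫ slope series = ∑' i, ∫ slopeTermᵢ`** along a continuous path `γ` on `[a, b]` whose points have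
norm `≤ r'` and stay `δ`-away from the inside pole set, `0 < δ ≤ 1 - r'` (dominated convergence with
the uniform bound `ScrewBorelGauss.norm_slopeTerm_le`). -/
theorem hasSum_intervalIntegral_slope {ι : Type*} [Countable ι] {c u : ι → ℂ}
    (hc : Summable fun i ↦ ‖c i‖) {γ : ℝ → ℂ} (hγ : Continuous γ)
    {a b : ℝ} (hab : a ≤ b) {r' δ : ℝ} (hδ : 0 < δ) (hδr : δ ≤ 1 - r')
    (hzr : ∀ t ∈ Icc a b, ‖γ t‖ ≤ r') (hfar : ∀ t ∈ Icc a b, ∀ q ∈ poleSet u, δ ≤ ‖q - γ t‖) :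
    HasSum (fun i ↦ ∫ t in a..b, slopeTerm (c i) (u i) (γ t))
      (∫ t in a..b, ∑' i, slopeTerm (c i) (u i) (γ t)) := by
  have hfar₁ : ∀ t ∈ Icc a b, ∀ i, ‖(u i)⁻¹‖ < 1 → δ ≤ ‖(u i)⁻¹ - γ t‖ :=
    fun t ht i hi ↦ hfar t ht _ ⟨hi, i, Or.inr rfl⟩
  have hfar₂ : ∀ t ∈ Icc a b, ∀ i, ‖u i‖ < 1 → δ ≤ ‖u i - γ t‖ :=
    fun t ht i hi ↦ hfar t ht _ ⟨hi, i, Or.inl rfl⟩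
  have hbd : ∀ t ∈ Icc a b, ∀ i, ‖slopeTerm (c i) (u i) (γ t)‖ ≤ 2 * ‖c i‖ / δ :=
    fun t ht i ↦ norm_slopeTerm_le hδ hδr (hzr t ht) (hfar₁ t ht i) (hfar₂ t ht i)
  have hda : ∀ t ∈ Icc a b, ∀ i, DifferentiableAt ℂ (fun w ↦ slopeTerm (c i) (u i) w) (γ t) := by
    intro t ht i
    have e1 := le_norm_sub_of_pole hδr (hzr t ht) (hfar₁ t ht i)
    have e2 := le_norm_sub_of_pole hδr (hzr t ht) (hfar₂ t ht i)
    have e3 := hδr.trans (one_sub_le_norm_one_sub (hzr t ht))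
    have n1 : (u i)⁻¹ - γ t ≠ 0 := fun h ↦ by rw [h, norm_zero] at e1; linarith
    have n2 : u i - γ t ≠ 0 := fun h ↦ by rw [h, norm_zero] at e2; linarith
    have n3 : 1 - γ t ≠ 0 := fun h ↦ by rw [h, norm_zero] at e3; linarith
    exact differentiableAt_slopeTerm n1 n2 n3
  have hcont : ∀ i, ContinuousOn (fun t ↦ slopeTerm (c i) (u i) (γ t)) (Icc a b) := fun i t ht ↦
    (((hda t ht i).continuousAt).comp hγ.continuousAt).continuousWithinAt
  have hsb : Summable fun i ↦ 2 * ‖c i‖ / δ := (hc.mul_left 2).div_const δ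
  have hI : Ι a b ⊆ Icc a b := by
    rw [uIoc_of_le hab]
    exact Ioc_subset_Icc_self
  refine intervalIntegral.hasSum_integral_of_dominated_convergence
    (fun i _ ↦ 2 * ‖c i‖ / δ) (fun i ↦ ?_) (fun i ↦ ?_) ?_ ?_ ?_
  · rw [uIoc_of_le hab]
    exact ((hcont i).mono Ioc_subset_Icc_self).aestronglyMeasurable measurableSet_Ioc
  · exact Eventually.of_forall fun t ht ↦ hbd t (hI ht) i
  · exact Eventually.of_forall fun t _ ↦ hsb
  · exact intervalIntegrable_const
  · refine Eventually.of_forall fun t ht ↦ ?_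
    exact (Summable.of_norm_bounded hsb (fun i ↦ hbd t (hI ht) i)).hasSum

/-- **Identity theorem for the slope pair.**  On a preconnected `V ∋ 0` inside
`𝔻 ∖ closure (poleSet u)`, the difference quotient `dslope F 0 = (F z - F 0)/z` (holomorphic on `𝔻`)
equals the slope series (the inline step of `ScrewBorelGauss.poleSet_inter_ball_eq_empty`, recorded). -/
theorem eqOn_dslope_of_preconnected {ι : Type*} {c u : ι → ℂ} (hc : Summable fun i ↦ ‖c i‖)
    (hu : ∀ i, u i ≠ 0) {F : ℂ → ℂ} (hF : DifferentiableOn ℂ F (ball 0 1)) {r₀ : ℝ} (hr₀ : 0 < r₀)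
    (hS : ∀ p ∈ poleSet u, r₀ ≤ ‖p‖)
    (hFB : EqOn F (fun z ↦ ∑' i, term (c i) (u i) z) (ball 0 r₀)) {V : Set ℂ}
    (hV : IsPreconnected V) (hV0 : (0 : ℂ) ∈ V) (hVsub : V ⊆ ball 0 1 \ closure (poleSet u)) :
    EqOn (dslope F 0) (fun z ↦ ∑' i, slopeTerm (c i) (u i) z) V := by
  -- shrink `r₀` below `1`
  set r₁ : ℝ := min r₀ (1 / 2) with hr₁
  have hr₁0 : 0 < r₁ := lt_min hr₀ one_half_pos
  have hr₁1 : r₁ ≤ 1 := (min_le_right _ _).trans (by norm_num)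
  have hS₁ : ∀ p ∈ poleSet u, r₁ ≤ ‖p‖ := fun p hp ↦ (min_le_left _ _).trans (hS p hp)
  have hFB₁ : EqOn F (fun z ↦ ∑' i, term (c i) (u i) z) (ball 0 r₁) :=
    hFB.mono (ball_subset_ball (min_le_left _ _))
  have hclos : closure (poleSet u) ⊆ {q : ℂ | r₁ ≤ ‖q‖} :=
    closure_minimal (fun p hp ↦ hS₁ p hp) (isClosed_le continuous_const continuous_norm)
  have hGd : DifferentiableOn ℂ (dslope F 0) (ball 0 1) :=
    (Complex.differentiableOn_dslope (ball_mem_nhds (0 : ℂ) one_pos)).2 hF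
  have hOpen : IsOpen (ball (0 : ℂ) 1 \ closure (poleSet u)) := isOpen_ball.sdiff isClosed_closure
  have hSd := differentiableOn_slopeSeries (u := u) hc
  -- the linking set `V' = V ∪ ball 0 r₁` and the base point `z₀ = r₁/2`
  set V' : Set ℂ := V ∪ ball 0 r₁ with hV'
  have hV'sub : V' ⊆ ball 0 1 \ closure (poleSet u) := by
    rintro z (hz | hz)
    · exact hVsub hz
    · have hzn : ‖z‖ < r₁ := mem_ball_zero_iff.1 hz
      refine ⟨mem_ball_zero_iff.2 (hzn.trans_le hr₁1), fun hzcl ↦ ?_⟩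
      have := hclos hzcl
      simp only [mem_setOf_eq] at this
      linarith
  have hV'pc : IsPreconnected V' :=
    IsPreconnected.union' ⟨0, hV0, mem_ball_self hr₁0⟩ hV (convex_ball (0 : ℂ) r₁).isPreconnected
  set z₀ : ℂ := ((r₁ / 2 : ℝ) : ℂ) with hz₀
  have hz₀n : ‖z₀‖ = r₁ / 2 := by
    rw [hz₀, Complex.norm_real, Real.norm_eq_abs, abs_of_pos (half_pos hr₁0)]
  have hz₀V' : z₀ ∈ V' := Or.inr (mem_ball_zero_iff.2 (by rw [hz₀n]; linarith))
  have hev : dslope F 0 =ᶠ[𝓝 z₀] fun z ↦ ∑' i, slopeTerm (c i) (u i) z := by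
    refine Filter.eventuallyEq_of_mem (ball_mem_nhds z₀ (half_pos hr₁0)) fun w hw ↦ ?_
    refine eqOn_dslope_slopeSeries hu hr₁1 hS₁ hFB₁ ⟨?_, ?_⟩
    · rw [mem_ball, dist_eq_norm] at hw
      rw [mem_ball_zero_iff]
      calc ‖w‖ = ‖z₀ + (w - z₀)‖ := by congr 1; ring
        _ ≤ ‖z₀‖ + ‖w - z₀‖ := norm_add_le _ _
        _ < r₁ := by rw [hz₀n]; linarith
    · intro hw0
      rw [mem_singleton_iff] at hw0
      rw [hw0, mem_ball, dist_comm, dist_zero_right, hz₀n] at hw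
      exact lt_irrefl _ hw
  have hGan : AnalyticOnNhd ℂ (dslope F 0) V' :=
    ((hGd.mono fun z hz ↦ hz.1).analyticOnNhd hOpen).mono hV'sub
  have hSan : AnalyticOnNhd ℂ (fun z ↦ ∑' i, slopeTerm (c i) (u i) z) V' :=
    (hSd.analyticOnNhd hOpen).mono hV'sub
  exact (hGan.eqOn_of_preconnected_of_eventuallyEq hSan hV'pc hz₀V' hev).mono subset_union_left

/-- Termwise integration of the slope series along a path segment inside a preconnected `V ∋ 0`,
`V ⊆ 𝔻 ∖ closure (poleSet u)`, on which `dslope F 0 = slope series`: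
`∑' i, ∫ slopeTermᵢ ∘ γ = ∫ (dslope F 0) ∘ γ`. -/
theorem hasSum_integral_path_slope {ι : Type*} [Countable ι] {c u : ι → ℂ}
    (hc : Summable fun i ↦ ‖c i‖) (hu : ∀ i, u i ≠ 0) {F : ℂ → ℂ}
    (hF : DifferentiableOn ℂ F (ball 0 1)) {r₀ : ℝ} (hr₀ : 0 < r₀)
    (hS : ∀ p ∈ poleSet u, r₀ ≤ ‖p‖)
    (hFB : EqOn F (fun z ↦ ∑' i, term (c i) (u i) z) (ball 0 r₀)) {V : Set ℂ}
    (hV : IsPreconnected V) (hV0 : (0 : ℂ) ∈ V) (hVsub : V ⊆ ball 0 1 \ closure (poleSet u))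
    {γ : ℝ → ℂ} (hγ : Continuous γ) {s t : ℝ} (hst : s ≤ t) (hγV : ∀ r ∈ Icc s t, γ r ∈ V) :
    HasSum (fun i ↦ ∫ r in s..t, slopeTerm (c i) (u i) (γ r)) (∫ r in s..t, dslope F 0 (γ r)) := by
  -- the compact trace of the segment, its norm bound and its separation from the pole set
  have hK : IsCompact (γ '' Icc s t) := isCompact_Icc.image hγ
  have hKV : γ '' Icc s t ⊆ V := by rintro _ ⟨r, hr, rfl⟩; exact hγV r hr
  obtain ⟨r', hr'1, hKr'⟩ : ∃ r' < 1, γ '' Icc s t ⊆ ball (0 : ℂ) r' :=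
    exists_lt_subset_ball hK.isClosed fun z hz ↦ (hVsub (hKV hz)).1
  have hdisj : Disjoint (γ '' Icc s t) (closure (poleSet u)) :=
    Set.disjoint_left.2 fun z hz hzcl ↦ (hVsub (hKV hz)).2 hzcl
  obtain ⟨δ₁, hδ₁, hsep⟩ := exists_separation hK hdisj
  set δ₂ : ℝ := min δ₁ (1 - r') with hδ₂
  have hδ₂0 : 0 < δ₂ := lt_min hδ₁ (by linarith)
  have hδ₂r : δ₂ ≤ 1 - r' := min_le_right _ _
  have hzr : ∀ r ∈ Icc s t, ‖γ r‖ ≤ r' := fun r hr ↦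
    (mem_ball_zero_iff.1 (hKr' ⟨r, hr, rfl⟩)).le
  have hfar : ∀ r ∈ Icc s t, ∀ q ∈ poleSet u, δ₂ ≤ ‖q - γ r‖ := fun r hr q hq ↦
    (min_le_left _ _).trans (hsep _ ⟨r, hr, rfl⟩ q hq)
  have h := hasSum_intervalIntegral_slope hc hγ hst hδ₂0 hδ₂r hzr hfar
  have hGV := eqOn_dslope_of_preconnected hc hu hF hr₀ hS hFB hV hV0 hVsub
  have e : (∫ r in s..t, ∑' i, slopeTerm (c i) (u i) (γ r)) = ∫ r in s..t, dslope F 0 (γ r) := by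
    refine intervalIntegral.integral_congr fun r hr ↦ ?_
    rw [uIcc_of_le hst] at hr
    exact (hGV (hγV r hr)).symm
  rwa [e] at h

end Summit.RiemannHypothesis.RiemannHypothesis.Theorems.Splittings.ScrewDust
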